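import Mathlib
import Summits.Ventures.PercRepro2.HCov

/-!
# The outside identities of the 3-coin class `N(b) = {a₂, u, c}` (blind cell PercRepro2, p4 g17;
S3 (G4-u) item (ad), proofs/P4-G17-COIN3.md)

On the outside instance `G − b` (marks `o, u, a₂, c`, weights `p⁰`): the Qsplit masses `W₀ = P(u ↮ a₂,
u ↮ c) = D₀ + t₀`, `P₀₀ = P(u ↮ a₂, a₂ ↮ c) = D₀ + t′₀` and their `o`-sections, the complements
`P(u ↔ a₂) = 1 − Z₀`, `P(a₂ ↔ c) = 1 − d₀₀`, `P(u ↔ a₂ ∨ a₂ ↔ c) = 1 − P₀₀`, `d_cu = d₀₀ − t′₀`,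
and the facts `P₀₀ ≤ d₀₀`, `d₀₀ + t₀ ≤ 1`, Harris `d_cu · Z₀ ≤ D₀` — the hypotheses of
`mixK_of_table` / `mixL_of_table` (RootLeafUCoin3AlgK / AlgL2) besides the mass table.
-/

namespace Summit.Ventures.PercRepro2

open UnionCluster CovForm

namespace RootLeafU

namespace Coin3

variable {V : Type*} {E : Type*} [Fintype E] [DecidableEq E] [Fintype V] [DecidableEq V]
  {R : Type*} [Field R] [LinearOrder R] [IsStrictOrderedRing R]

section Outside

variable (p : E → R) (ends : E → Sym2 V) (o u a₂ c : V)

omit [Fintype E] [DecidableEq E] [Fintype V] [DecidableEq V] [LinearOrder R] [IsStrictOrderedRing R] in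
/-- `avoidAll s {x} = (connEvent s x)ᶜ`. -/
lemma avoidAll_singleton_eq_compl (s x : V) : avoidAll ends s {x} = (connEvent ends s x)ᶜ := by
  ext ω
  simp [mem_avoidAll]

omit [Fintype V] [LinearOrder R] [IsStrictOrderedRing R] in
/-- `W₀ = P(u ↮ a₂, u ↮ c) = D₀ + t₀`. -/
lemma out_W0 : prob p (avoidAll ends a₂ {u} ∩ (connEvent ends u c)ᶜ) =
    prob p (PDEvent ends u a₂ c) + prob p (TEvent ends u a₂ c) := by
  rw [Qsplit p ends u a₂ c]
  have e1 : PDEvent ends u a₂ c ∩ (connEvent ends u c)ᶜ = PDEvent ends u a₂ c := by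
    ext ω
    simp only [PDEvent, Dtilde, Set.mem_inter_iff, Set.mem_compl_iff, mem_connEvent, mem_inU]
    exact ⟨fun h => h.1, fun h => ⟨h, fun h' => h.2 (Or.inl (conn_symm h'))⟩⟩
  have e2 : TEvent ends u a₂ c ∩ (connEvent ends u c)ᶜ = TEvent ends u a₂ c := by
    ext ω
    simp only [TEvent, Set.mem_inter_iff, Set.mem_compl_iff, mem_connEvent]
    exact ⟨fun h => h.1, fun h => ⟨h, fun h' => h.1 (conn_trans h.2 (conn_symm h'))⟩⟩
  have e3 : TEvent ends a₂ u c ∩ (connEvent ends u c)ᶜ = ∅ := by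
    ext ω
    simp only [TEvent, Set.mem_inter_iff, Set.mem_compl_iff, mem_connEvent, Set.mem_empty_iff_false,
      iff_false, not_and, not_not]
    exact fun h => h.2
  rw [e1, e2, e3, prob_empty, add_zero]

omit [Fintype V] [LinearOrder R] [IsStrictOrderedRing R] in
/-- `P₀₀ = P(u ↮ a₂, a₂ ↮ c) = D₀ + t′₀`. -/
lemma out_P00 : prob p (avoidAll ends a₂ {u} ∩ (connEvent ends a₂ c)ᶜ) =
    prob p (PDEvent ends u a₂ c) + prob p (TEvent ends a₂ u c) := by
  rw [Qsplit p ends u a₂ c]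
  have e1 : PDEvent ends u a₂ c ∩ (connEvent ends a₂ c)ᶜ = PDEvent ends u a₂ c := by
    ext ω
    simp only [PDEvent, Dtilde, Set.mem_inter_iff, Set.mem_compl_iff, mem_connEvent, mem_inU]
    exact ⟨fun h => h.1, fun h => ⟨h, fun h' => h.2 (Or.inr (conn_symm h'))⟩⟩
  have e2 : TEvent ends u a₂ c ∩ (connEvent ends a₂ c)ᶜ = ∅ := by
    ext ω
    simp only [TEvent, Set.mem_inter_iff, Set.mem_compl_iff, mem_connEvent, Set.mem_empty_iff_false,
      iff_false, not_and, not_not]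
    exact fun h => h.2
  have e3 : TEvent ends a₂ u c ∩ (connEvent ends a₂ c)ᶜ = TEvent ends a₂ u c := by
    ext ω
    simp only [TEvent, Set.mem_inter_iff, Set.mem_compl_iff, mem_connEvent]
    exact ⟨fun h => h.1, fun h => ⟨h, fun h' => h.1 (conn_trans h.2 (conn_symm h'))⟩⟩
  rw [e1, e2, e3, prob_empty, add_zero]

omit [Fintype V] [DecidableEq V] [LinearOrder R] [IsStrictOrderedRing R] in
/-- `P(u ↔ a₂) = 1 − Z₀`. -/
lemma out_hua : prob p (connEvent ends u a₂) = 1 - prob p (avoidAll ends a₂ {u}) := by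
  have e : avoidAll ends a₂ {u} = (connEvent ends u a₂)ᶜ := by
    ext ω
    simp only [mem_avoidAll, Finset.mem_singleton, forall_eq, Set.mem_compl_iff, mem_connEvent]
    exact ⟨fun h h' => h (conn_symm h'), fun h h' => h (conn_symm h')⟩
  rw [e, prob_compl]
  ring

omit [Fintype V] [DecidableEq V] [LinearOrder R] [IsStrictOrderedRing R] in
/-- `P(a₂ ↔ c) = 1 − d₀₀`. -/
lemma out_hca : prob p (connEvent ends a₂ c) = 1 - prob p (avoidAll ends a₂ {c}) := by
  rw [avoidAll_singleton_eq_compl, prob_compl]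
  ring

omit [Fintype V] [DecidableEq V] [LinearOrder R] [IsStrictOrderedRing R] in
/-- `P(u ↔ a₂ ∨ a₂ ↔ c) = 1 − P₀₀`. -/
lemma out_hor : prob p (connEvent ends u a₂ ∪ connEvent ends a₂ c) =
    1 - prob p (avoidAll ends a₂ {u} ∩ (connEvent ends a₂ c)ᶜ) := by
  have e : avoidAll ends a₂ {u} ∩ (connEvent ends a₂ c)ᶜ =
      (connEvent ends u a₂ ∪ connEvent ends a₂ c)ᶜ := by
    ext ω
    simp only [mem_avoidAll, Finset.mem_singleton, forall_eq, Set.mem_compl_iff, mem_connEvent,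
      Set.mem_inter_iff, Set.mem_union, not_or]
    exact ⟨fun h => ⟨fun h' => h.1 (conn_symm h'), h.2⟩, fun h => ⟨fun h' => h.1 (conn_symm h'), h.2⟩⟩
  rw [e, prob_compl]
  ring

omit [Fintype V] [DecidableEq V] [LinearOrder R] [IsStrictOrderedRing R] in
/-- `d_cu = P(c ↮ a₂, c ↮ u) = d₀₀ − t′₀`. -/
lemma out_dcu : prob p (avoidAll ends a₂ {c} ∩ (connEvent ends u c)ᶜ) =
    prob p (avoidAll ends a₂ {c}) - prob p (TEvent ends a₂ u c) := by
  have h := prob_inter_add_prob_inter_compl p (avoidAll ends a₂ {c}) (connEvent ends u c)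
  have e : avoidAll ends a₂ {c} ∩ connEvent ends u c = TEvent ends a₂ u c := by
    ext ω
    simp only [mem_avoidAll, Finset.mem_singleton, forall_eq, Set.mem_inter_iff, mem_connEvent, TEvent,
      Set.mem_compl_iff]
    constructor
    · rintro ⟨h1, h2⟩
      exact ⟨fun h' => h1 (conn_trans (conn_symm h') h2), h2⟩
    · rintro ⟨h1, h2⟩
      exact ⟨fun h' => h1 (conn_symm (conn_trans h' (conn_symm h2))), h2⟩
  rw [e] at h
  linear_combination h

omit [Fintype V] [LinearOrder R] [IsStrictOrderedRing R] in
/-- `P(u ↮ a₂, a₂ ↮ c, o ∈ K) = PD₀oK + T′₀oK`. -/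
lemma out_P00oK : prob p (avoidAll ends a₂ {u} ∩ (connEvent ends a₂ c)ᶜ ∩ connEvent ends a₂ o) =
    prob p (PDEvent ends u a₂ c ∩ connEvent ends a₂ o) +
      prob p (TEvent ends a₂ u c ∩ connEvent ends a₂ o) := by
  rw [Set.inter_assoc, Qsplit p ends u a₂ c]
  have e1 : PDEvent ends u a₂ c ∩ ((connEvent ends a₂ c)ᶜ ∩ connEvent ends a₂ o) =
      PDEvent ends u a₂ c ∩ connEvent ends a₂ o := by
    ext ω
    simp only [PDEvent, Dtilde, Set.mem_inter_iff, Set.mem_compl_iff, mem_connEvent, mem_inU]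
    exact ⟨fun h => ⟨h.1, h.2.2⟩, fun h => ⟨h.1, fun h' => h.1.2 (Or.inr (conn_symm h')), h.2⟩⟩
  have e2 : TEvent ends u a₂ c ∩ ((connEvent ends a₂ c)ᶜ ∩ connEvent ends a₂ o) = ∅ := by
    ext ω
    simp only [TEvent, Set.mem_inter_iff, Set.mem_compl_iff, mem_connEvent, Set.mem_empty_iff_false,
      iff_false, not_and]
    exact fun h h' => absurd h.2 h'
  have e3 : TEvent ends a₂ u c ∩ ((connEvent ends a₂ c)ᶜ ∩ connEvent ends a₂ o) =
      TEvent ends a₂ u c ∩ connEvent ends a₂ o := by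
    ext ω
    simp only [TEvent, Set.mem_inter_iff, Set.mem_compl_iff, mem_connEvent]
    exact ⟨fun h => ⟨h.1, h.2.2⟩, fun h => ⟨h.1, fun h' => h.1.1 (conn_trans h.1.2 (conn_symm h')), h.2⟩⟩
  rw [e1, e2, e3, prob_empty, add_zero]

omit [Fintype V] [LinearOrder R] [IsStrictOrderedRing R] in
/-- `P(u ↮ a₂, u ↮ c, o ∈ L) = PD₀oL + T₀oL`. -/
lemma out_W0oL : prob p (avoidAll ends a₂ {u} ∩ (connEvent ends u c)ᶜ ∩ connEvent ends u o) =
    prob p (PDEvent ends u a₂ c ∩ connEvent ends u o) +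
      prob p (TEvent ends u a₂ c ∩ connEvent ends u o) := by
  rw [Set.inter_assoc, Qsplit p ends u a₂ c]
  have e1 : PDEvent ends u a₂ c ∩ ((connEvent ends u c)ᶜ ∩ connEvent ends u o) =
      PDEvent ends u a₂ c ∩ connEvent ends u o := by
    ext ω
    simp only [PDEvent, Dtilde, Set.mem_inter_iff, Set.mem_compl_iff, mem_connEvent, mem_inU]
    exact ⟨fun h => ⟨h.1, h.2.2⟩, fun h => ⟨h.1, fun h' => h.1.2 (Or.inl (conn_symm h')), h.2⟩⟩
  have e2 : TEvent ends u a₂ c ∩ ((connEvent ends u c)ᶜ ∩ connEvent ends u o) =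
      TEvent ends u a₂ c ∩ connEvent ends u o := by
    ext ω
    simp only [TEvent, Set.mem_inter_iff, Set.mem_compl_iff, mem_connEvent]
    exact ⟨fun h => ⟨h.1, h.2.2⟩, fun h => ⟨h.1, fun h' => h.1.1 (conn_trans h.1.2 (conn_symm h')), h.2⟩⟩
  have e3 : TEvent ends a₂ u c ∩ ((connEvent ends u c)ᶜ ∩ connEvent ends u o) = ∅ := by
    ext ω
    simp only [TEvent, Set.mem_inter_iff, Set.mem_compl_iff, mem_connEvent, Set.mem_empty_iff_false,
      iff_false, not_and]
    exact fun h h' => absurd h.2 h'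
  rw [e1, e2, e3, prob_empty, add_zero]

omit [Fintype V] in
/-- `P₀₀ ≤ d₀₀`. -/
lemma fact_sig (hp : IsProbVec p) :
    prob p (PDEvent ends u a₂ c) + prob p (TEvent ends a₂ u c) ≤ prob p (avoidAll ends a₂ {c}) := by
  rw [← out_P00]
  refine prob_mono hp ?_
  intro ω hω
  simp only [mem_avoidAll, Finset.mem_singleton, forall_eq, Set.mem_inter_iff, Set.mem_compl_iff,
    mem_connEvent] at hω ⊢
  exact hω.2

omit [Fintype V] [DecidableEq V] in
/-- `d₀₀ + t₀ ≤ 1` (disjoint events). -/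
lemma fact_mu (hp : IsProbVec p) :
    prob p (avoidAll ends a₂ {c}) + prob p (TEvent ends u a₂ c) ≤ 1 := by
  have hd : Disjoint (avoidAll ends a₂ {c}) (TEvent ends u a₂ c) := by
    rw [Set.disjoint_left]
    intro ω h1 h2
    simp only [mem_avoidAll, Finset.mem_singleton, forall_eq] at h1
    exact h1 h2.2
  rw [← prob_union_of_disjoint p hd]
  exact prob_le_one hp _

omit [Fintype V] [DecidableEq V] in
/-- Harris: `d_cu · Z₀ ≤ D₀`. -/
lemma fact_Hs (hp : IsProbVec p) :
    prob p (avoidAll ends a₂ {c} ∩ (connEvent ends u c)ᶜ) * prob p (avoidAll ends a₂ {u}) ≤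
      prob p (PDEvent ends u a₂ c) := by
  have hA : IsLowerSet (avoidAll ends a₂ {c} ∩ (connEvent ends u c)ᶜ) := by
    rw [avoidAll_singleton_eq_compl]
    exact (isUpperSet_connEvent ends a₂ c).compl.inter (isUpperSet_connEvent ends u c).compl
  have hB : IsLowerSet (avoidAll ends a₂ {u}) := by
    rw [avoidAll_singleton_eq_compl]
    exact (isUpperSet_connEvent ends a₂ u).compl
  have h := prob_mul_prob_le_prob_inter_of_isLowerSet hp hA hB
  have e : avoidAll ends a₂ {c} ∩ (connEvent ends u c)ᶜ ∩ avoidAll ends a₂ {u} = PDEvent ends u a₂ c := by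
    ext ω
    simp only [mem_avoidAll, Finset.mem_singleton, forall_eq, Set.mem_inter_iff, Set.mem_compl_iff,
      mem_connEvent, PDEvent, Dtilde, mem_inU, not_or]
    constructor
    · rintro ⟨⟨h1, h2⟩, h3⟩
      exact ⟨fun h' => h3 (conn_symm h'), fun h' => h2 (conn_symm h'), fun h' => h1 (conn_symm h')⟩
    · rintro ⟨h1, h2, h3⟩
      exact ⟨⟨fun h' => h3 (conn_symm h'), fun h' => h2 (conn_symm h')⟩, fun h' => h1 (conn_symm h')⟩
  rw [e] at h
  exact h

end Outside

end Coin3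

end RootLeafU

end Summit.Ventures.PercRepro2
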